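import Summits.ResolutionOfSingularities.ResolutionOfSingularities.Theorems.PurelyInseparableDim4ResConeFourWeights
import Summits.ResolutionOfSingularities.ResolutionOfSingularities.Theorems.PurelyInseparableDim4ResConeKeepBudget
import HarnessLib
import HarnessLib.Audit.Tags

/-!
# Purely inseparable four-folds — RECURRENCE in the shade-`4` weight automaton at `p = 5`: in the D∞ branch both
# `(2)`-states and `(2,1)`-states occur beyond every index (cell `res-dim4-pi`, K2(p) lane, slice C at `(5,4)`; holder brick W₄′)

[OURS · counted 0 · cell `res-dim4-pi` · K2(p) lane holder res-dim4-p-12 g4 (memo §17, complement of brick W₄; the `(5,4)` twin of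
`…ThreeWeightsRecurrence` p701342).]  Nothing here proves K2(5) (`RidgeBudget.NoAboveFloorTrap 5 5`), `NoIsolatedTrap 5 5` or
resolution of singularities in dimension ≥ 4 / characteristic `p` — NOT proved.  AI kernel work, weaker than expert review.

Brick W₄ (`…ResConeFourWeights`) splits a constant-shade-`4` tail at `p = 5` into the LIGHT PAIR branch `(1,1)` and the D∞ branch
(one weight-`2` letter for ever; `(2)` and `(2,1)`), FT-free.  This file adds the two RECURRENCES of the D∞ branch:
* `frequently_degree_two` — `(2)`-states occur beyond every index (W₄'s `no_four_tail_of_degree_two_budget` with budget `0`;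
  FT-free: a `(2,1)`-run for ever sits in the upper band `o ≡ 7`);
* **`exists_degree_three₄`** — `(2,1)`-states occur beyond every index in the D∞ branch (uses FT through
  `no_tail_of_eventually_free`: a `(2)`-run for ever keeps its heavy letter and must hit the previous newborn light letter at
  every step — a free tail).
So a D∞ tail alternates between `(2)` and `(2,1)` for ever.

[cite: CossartJannsenSaito2020, Thm. 3.14] [cite: HauserPerlega2019PRIMS, §2 (transform D′ of D)]
bears_on: LADDER-RESOLUTION:D157-DOOR2 (res-dim4-pi · K2(p) · slice C `(5,4)` weights, recurrence).  Supports
stmt-ResolutionOfSingularities-16155 (helper).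
-/

set_option linter.dupNamespace false -- mandated namespace of this single-conjunct summit

noncomputable section

namespace Summit.ResolutionOfSingularities.ResolutionOfSingularities.Theorems.PIDim4

namespace ResCone

open MvPolynomial Finset
open Literature.AlgebraicGeometry.Resolution
open Literature.AlgebraicGeometry.Resolution.CentreBlowup
open Literature.AlgebraicGeometry.Resolution.Hauser2010
open Literature.AlgebraicGeometry.Resolution.HauserPerlega2019

variable {K : Type} [Field K] [CharP K 5] [DecidableEq K]

/-- **`(2)`-STATES RECUR** (any branch): along a witnessed isolated above-floor `Step0 5` chain with `x^{r₀} ∣ F₀` and constant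
shade `4` from `k₀`, beyond every index `n ≥ k₀` there is a state with `|r_k| = 2` (`o_k = 6`). [OURS]
[cite: CossartJannsenSaito2020, Thm. 3.14] -/
theorem frequently_degree_two {c : ℕ → State K} {j : ℕ → Fin 4} {b : ℕ → Fin 4 → K}
    (hc : ∀ k, IsIsolated 5 (c k).F ∧ Step0 5 (c k) (c (k + 1))) (hw : FreeTail.IsWitnessedChain 5 c j b)
    (hr0 : ∀ e ∈ (c 0).F.support, (c 0).r ≤ e) (hfloor : ∀ k, ordZero (c k).F ≠ 5) {k₀ : ℕ}
    (hshade : ∀ k, k₀ ≤ k → (c k).shade = ((4 : ℕ) : ℕ∞)) (n : ℕ) (hn : k₀ ≤ n) :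
    ∃ k, n ≤ k ∧ (c k).r.degree = 2 := by
  classical
  by_contra hno
  push Not at hno
  refine no_four_tail_of_degree_two_budget hc hw hr0 hfloor hshade (k₁ := n) hn (B := 0) fun m => ?_
  rw [Nat.le_zero, Finset.card_eq_zero, Finset.filter_eq_empty_iff]
  intro i _
  exact hno (n + i) (Nat.le_add_right n i)

/-- **`(2,1)`-STATES RECUR in the D∞ branch**: along a witnessed isolated above-floor `Step0 5` chain with `x^{r₀} ∣ F₀` and
constant shade `4` from `k₀`, if every state from `k₁` on carries a weight-`2` letter then beyond every index there is a state
with `|r_k| = 3`.  Otherwise the tail is `(2)` for ever: the heavy letter is kept, the newborn letter weighs `1`, and the NEXT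
step must hit it (else `|r| = 3`) — a free tail, excluded by FT (`no_tail_of_eventually_free`). [OURS]
[cite: CossartJannsenSaito2020, Thm. 3.14] -/
theorem exists_degree_three₄ {c : ℕ → State K} {j : ℕ → Fin 4} {b : ℕ → Fin 4 → K}
    (hc : ∀ k, IsIsolated 5 (c k).F ∧ Step0 5 (c k) (c (k + 1))) (hw : FreeTail.IsWitnessedChain 5 c j b)
    (hr0 : ∀ e ∈ (c 0).F.support, (c 0).r ≤ e) (hfloor : ∀ k, ordZero (c k).F ≠ 5) {k₀ : ℕ}
    (hshade : ∀ k, k₀ ≤ k → (c k).shade = ((4 : ℕ) : ℕ∞)) {k₁ : ℕ} (hk₁ : k₀ ≤ k₁)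
    (hheavy : ∀ k, k₁ ≤ k → ∃ W, (c k).r W = 2) (n : ℕ) (hn : k₁ ≤ n) :
    ∃ k, n ≤ k ∧ (c k).r.degree = 3 := by
  haveI : Fact (Nat.Prime 5) := ⟨by norm_num⟩
  by_contra hno
  push Not at hno
  obtain ⟨-, hlaw, hbj, hfl, hpair⟩ := four_weights_laws hc hw hr0 hfloor hshade
  -- every state from `n` on is a `(2)`-state: degree `≤ 3` in the heavy branch (two steps in), never `3`
  have h2 : ∀ k, n + 2 ≤ k → (c k).r.degree = 2 := fun k hk => by
    have hh : ∀ k, k₁ ≤ k → ∃ W, 2 ≤ (c k).r W := fun k hk => by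
      obtain ⟨W, hW⟩ := hheavy k hk; exact ⟨W, hW.ge⟩
    have h := (dInf_of_heavy hlaw hbj hfl hpair hk₁ hh (k := k) (by omega)).2
    have := hno k (by omega)
    omega
  refine no_tail_of_eventually_free 5 hc hw (k₁ := n + 2) fun k hk => ?_
  obtain ⟨W, hW⟩ := hheavy (k + 1) (by omega)
  obtain ⟨hjW, hbW, hW', hnew⟩ :=
    (dInf_pattern hc hw hr0 hfloor hshade (k := k + 1) (by omega) hW).1 (h2 (k + 1) (by omega))
  by_contra hfree
  push Not at hfree
  obtain ⟨hjj, hbb⟩ := hfree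
  -- `j k` is kept at step `k+1` with its weight `1`
  have hold : (c (k + 1 + 1)).r (j k) = (c (k + 1)).r (j k) :=
    apply_succ_kept_of_update (r := fun k => (c k).r) (hlaw (k + 1) (by omega)) hjj hbb
  have hjk1 : (c (k + 1)).r (j k) = 1 := by
    have h := apply_succ_self_of_update (r := fun k => (c k).r) (hlaw k (by omega))
    have h2k := h2 k hk
    simp only [h2k] at h
    exact h
  have hWj : j k ≠ W := by
    intro hh
    rw [hh] at hjk1
    omega
  -- `W` (weight 2) and `j k` (weight 1) at `k + 2` make `|r| ≥ 3`
  have hdeg : (c (k + 1 + 1)).r W + (c (k + 1 + 1)).r (j k) ≤ (c (k + 1 + 1)).r.degree := by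
    classical
    rw [Finsupp.degree_eq_sum]
    have h := Finset.sum_le_sum_of_subset (f := fun t => (c (k + 1 + 1)).r t)
      (Finset.subset_univ ({W, j k} : Finset (Fin 4)))
    rwa [Finset.sum_pair (Ne.symm hWj)] at h
  rw [hW', hold, hjk1, h2 (k + 1 + 1) (by omega)] at hdeg
  omega

end ResCone

end Summit.ResolutionOfSingularities.ResolutionOfSingularities.Theorems.PIDim4

end
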